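import Summits.Ventures.DiscreteObjects.PP12.FlagOrbitSums
import Summits.Ventures.DiscreteObjects.PP12.FlagOrbitEndgame

/-!
# PP(12), flag cell of order 3: the GENERIC ORBIT-MATRIX REDUCTION holds for every number `ρ` of c-line orbits (kernel; Step D — λ = 1 systems, assembly)
Framing: lottery ticket; floor = certified bounds/negative ranges.

Cell pub-namedobj (venture DiscreteObjects), target (M), designs gen 15. For the matrix `flagMatR` READ OFF a putative projective plane of order 12 with a
flag-type collineation `σ`, `σ³ = 1`, exactly `13 − 3ρ` fixed points (`FlagOrbitSums`): conjunct 3 `flagMatR_rows` (every row inner product is the one forced by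
`λ = 1` — `OrbitSideIdentities.orbit_row_identity_orbits` transported along the column bijection `FlagOrbitCols.sum_colOrbitR`, the common fixed points of
the two representative lines counted by row type: `c` for two c-lines, `y_k` for two T-lines through `y_k`, none otherwise) and conjunct 4 `flagMatR_cols`
(dually, `orbit_column_identity_orbits`, incidence symmetry `flagMatR_eq_card_lines`, common fixed lines `l` / `m_j` / none); with conjuncts 1, 2, 5, 6, 7 of
`FlagOrbitSums`: **`isFlagOrbitMatrix_ofPlane`** and **`flagOrbitReduction_holds ρ : FlagOrbitReduction ρ` for EVERY `ρ`** — designs g15's typed statement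
`FlagOrbitMatrix.FlagOrbitReduction` is a theorem uniformly in `ρ`; in particular the sub-cells `f = 4` (`ρ = 3`) and `f = 1` (`ρ = 4`) now have finite
orbit-matrix statements with kernel reductions (`noFlagFixed_of_noFlagOrbitMatrix`), next to the structured ones of `f = 10, 7` (`FlagTenOrbitReduction`,
`FlagSevenOrbitReduction`). Also the case `ρ = 0` = ELATIONS of order 3 (`noElationOrder3_of_noFlagOrbitMatrix_zero`: all 13 points of `l` fixed; in print:
Janko–van Trung 1981), so that the whole live cell `|G| = 3` follows from the five finite statements `NoFlagOrbitMatrix ρ`, `ρ = 0, …, 4`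
(`noOrderThree_of_flagOrbitMatrices`, the planar type being the theorem `noPlanarOrder3Order12`), and the rigid endgame v8
`card_collineationGroup_eq_one_v8`. CENSUS STATUS (2026-08-23): `NoFlagOrbitMatrix ρ` is UNDECIDED for every `ρ` in the plain form (for `ρ = 1` the finer
structured orbit level `NoFlagTenOrbitMatrix` is decided EMPTY outside the kernel; `ρ = 0` is excluded in print); nothing here asserts any of them.
Classical mathematics (tactical decompositions, Dembowski §4.1) formalised. No `sorry`, no new axioms.
-/

namespace Summit.Ventures.DiscreteObjects.PP12

open Configuration Finset
open scoped Classical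

namespace Collineation

variable {P L : Type*} [Membership P L] [ProjectivePlane P L] [Fintype P] [Fintype L] (σ : Collineation P L)

section Flag

variable {l : L} {c : P}

section Data

variable (hl : σ.onLines l = l) (hc : σ.onPoints c = c) (hcl : c ∈ l)
  (hP : ∀ p : P, σ.onPoints p = p → p ∈ l) (hL : ∀ m : L, σ.onLines m = m → c ∈ m) (h12 : ProjectivePlane.order P L = 12)
  (hq : σ.onPoints ^ 3 = 1) {ρ : ℕ} (hf : fixedCard σ.onPoints = 13 - 3 * ρ)

/-- **Conjunct 3 of `IsFlagOrbitMatrix`:** all row inner products are as forced by `λ = 1`. -/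
theorem flagMatR_rows (r r' : FRow ρ) :
    ∑ c₀ : FCol ρ, σ.flagMatR hl hc hcl hP hL h12 hq hf r c₀ * σ.flagMatR hl hc hcl hP hL h12 hq hf r' c₀ = FlagOrbit.rowTarget r r' := by
  have hqL : σ.onLines ^ 3 = 1 := σ.onLines_pow_eq_one hq
  set a := σ.lineRepR hl hc hcl hP hL h12 hq hf r with ha
  set a' := σ.lineRepR hl hc hcl hP hL h12 hq hf r' with ha'
  have hsum : ∑ c₀ : FCol ρ, σ.flagMatR hl hc hcl hP hL h12 hq hf r c₀ * σ.flagMatR hl hc hcl hP hL h12 hq hf r' c₀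
      = ∑ S ∈ σ.orbits3, (S.filter fun q => q ∈ a).card * (S.filter fun q => q ∈ a').card :=
    σ.sum_colOrbitR hl hc hcl hP hL h12 hq hf (fun S => (S.filter fun q => q ∈ a).card * (S.filter fun q => q ∈ a').card)
  have hna' : σ.onLines a' ≠ a' := σ.lineRepR_not_fixed hl hc hcl hP hL h12 hq hf r'
  have hsame : a ∈ orb3 σ.onLines a' ↔ r = r' := by
    constructor
    · intro h
      apply σ.rowOrbitR_injective hl hc hcl hP hL h12 hq hf
      rw [σ.rowOrbitR_eq_orb3_lineRepR hl hc hcl hP hL h12 hq hf r, σ.rowOrbitR_eq_orb3_lineRepR hl hc hcl hP hL h12 hq hf r']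
      exact orb3_eq_of_mem σ.onLines hqL h
    · intro h; rw [ha, ha', h]; exact self_mem_orb3 _ _
  have hid := σ.orbit_row_identity_orbits hq hna' a
  rw [h12, ← hsum] at hid
  obtain ⟨hΓ, hside, hT⟩ := σ.lineRepR_fixed_facts hl hc hcl hP hL h12 hq hf
  -- the common-fixed-point count F, by row types
  set F := (univ.filter fun q : P => q ∈ a ∧ q ∈ a' ∧ σ.onPoints q = q).card with hF
  have hF0 : (∀ q : P, σ.onPoints q = q → q ∈ a → q ∈ a' → False) → F = 0 := by
    intro h; rw [hF, card_eq_zero, filter_eq_empty_iff]; intro q _ ⟨h1, h2, h3⟩; exact h q h3 h1 h2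
  have hF1 : ∀ y : P, y ∈ a → y ∈ a' → σ.onPoints y = y → (∀ q : P, σ.onPoints q = q → q ∈ a → q = y) → F = 1 := by
    intro y hya hya' hy huniq
    rw [hF, card_eq_one]
    refine ⟨y, ?_⟩
    ext q
    rw [mem_filter, mem_singleton]
    constructor
    · rintro ⟨-, h1, -, h3⟩; exact huniq q h3 h1
    · intro h; rw [h]; exact ⟨mem_univ _, hya, hya', hy⟩
  rcases r with s | x | ⟨k, t⟩ <;> rcases r' with s' | x' | ⟨k', t'⟩
  · -- Γ / Γ : the common fixed point c
    have hFv : F = 1 := hF1 c (hΓ s).1 (hΓ s').1 hc (hΓ s).2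
    rw [hFv] at hid
    simp only [FlagOrbit.rowTarget]
    by_cases hss : s = s'
    · subst hss; rw [if_pos (hsame.2 rfl)] at hid; rw [if_pos rfl]; omega
    · rw [if_neg (fun h => hss (Sum.inl.inj (hsame.1 h)))] at hid; rw [if_neg hss]; omega
  · have hFv : F = 0 := hF0 (fun q hqf _ hq2 => hside x' q hqf hq2)
    rw [hFv, if_neg (fun h => by cases hsame.1 h)] at hid
    simp only [FlagOrbit.rowTarget]; omega
  · have hFv : F = 0 := hF0 (fun q hqf hq1 hq2 => by cases (hΓ s).2 q hqf hq1; exact (hT k' t').2.1 hq2)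
    rw [hFv, if_neg (fun h => by cases hsame.1 h)] at hid
    simp only [FlagOrbit.rowTarget]; omega
  · have hFv : F = 0 := hF0 (fun q hqf hq1 _ => hside x q hqf hq1)
    rw [hFv, if_neg (fun h => by cases hsame.1 h)] at hid
    simp only [FlagOrbit.rowTarget]; omega
  · -- side / side
    have hFv : F = 0 := hF0 (fun q hqf hq1 _ => hside x q hqf hq1)
    rw [hFv] at hid
    simp only [FlagOrbit.rowTarget]
    by_cases hxx : x = x'
    · subst hxx; rw [if_pos (hsame.2 rfl)] at hid; rw [if_pos rfl]; omega
    · rw [if_neg (fun h => hxx (by have := hsame.1 h; simp only [Sum.inr.injEq, Sum.inl.injEq] at this; exact this))] at hid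
      rw [if_neg hxx]; omega
  · have hFv : F = 0 := hF0 (fun q hqf hq1 _ => hside x q hqf hq1)
    rw [hFv, if_neg (fun h => by cases hsame.1 h)] at hid
    simp only [FlagOrbit.rowTarget]; omega
  · have hFv : F = 0 := hF0 (fun q hqf hq1 hq2 => by cases (hΓ s').2 q hqf hq2; exact (hT k t).2.1 hq1)
    rw [hFv, if_neg (fun h => by cases hsame.1 h)] at hid
    simp only [FlagOrbit.rowTarget]; omega
  · have hFv : F = 0 := hF0 (fun q hqf _ hq2 => hside x' q hqf hq2)
    rw [hFv, if_neg (fun h => by cases hsame.1 h)] at hid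
    simp only [FlagOrbit.rowTarget]; omega
  · -- T / T : common fixed point y_k iff k = k'
    simp only [FlagOrbit.rowTarget]
    by_cases hkk : k = k'
    · subst hkk
      have hFv : F = 1 := hF1 _ (hT k t).1 (hT k t').1 (σ.eFixPR hc hf k).2.1 (hT k t).2.2
      rw [hFv] at hid
      by_cases htt : t = t'
      · subst htt; rw [if_pos (hsame.2 rfl)] at hid; rw [if_pos rfl]; omega
      · rw [if_neg (fun h => htt (by have := hsame.1 h; simp only [Sum.inr.injEq, Prod.mk.injEq, true_and] at this; exact this))] at hid
        rw [if_neg (fun h => htt (by simp only [Prod.mk.injEq, true_and] at h; exact h)), if_pos rfl]; omega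
    · have hyy : (σ.eFixPR hc hf k).1 ≠ (σ.eFixPR hc hf k').1 := fun e => hkk ((σ.eFixPR hc hf).injective (Subtype.ext e))
      have hFv : F = 0 := hF0 (fun q hqf hq1 hq2 => hyy (((hT k t).2.2 q hqf hq1).symm.trans ((hT k' t').2.2 q hqf hq2)))
      rw [hFv, if_neg (fun h => hkk (by have := hsame.1 h; simp only [Sum.inr.injEq, Prod.mk.injEq] at this; exact this.1))] at hid
      rw [if_neg (fun h => hkk (by simp only [Prod.mk.injEq] at h; exact h.1)), if_neg hkk]; omega

/-- **Conjunct 4 of `IsFlagOrbitMatrix`:** all column inner products are as forced by `λ = 1` (dually). -/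
theorem flagMatR_cols (c₁ c₂ : FCol ρ) :
    ∑ r : FRow ρ, σ.flagMatR hl hc hcl hP hL h12 hq hf r c₁ * σ.flagMatR hl hc hcl hP hL h12 hq hf r c₂ = FlagOrbit.colTarget c₁ c₂ := by
  set q := σ.pointRepR hl hc hcl hP hL h12 hq hf c₁ with hqdef
  set p := σ.pointRepR hl hc hcl hP hL h12 hq hf c₂ with hpdef
  obtain ⟨hco1, hqf⟩ := σ.colOrbitR_eq_orb3_pointRepR hl hc hcl hP hL h12 hq hf c₁
  obtain ⟨hco2, hpf⟩ := σ.colOrbitR_eq_orb3_pointRepR hl hc hcl hP hL h12 hq hf c₂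
  have hsum : ∑ r : FRow ρ, σ.flagMatR hl hc hcl hP hL h12 hq hf r c₁ * σ.flagMatR hl hc hcl hP hL h12 hq hf r c₂
      = ∑ B ∈ σ.lineOrbits3, (B.filter fun m => q ∈ m).card * (B.filter fun m => p ∈ m).card := by
    rw [← σ.sum_rowOrbitR hl hc hcl hP hL h12 hq hf (fun B => (B.filter fun m => q ∈ m).card * (B.filter fun m => p ∈ m).card)]
    refine Finset.sum_congr rfl fun r _ => ?_
    rw [σ.flagMatR_eq_card_lines hl hc hcl hP hL h12 hq hf r c₁, σ.flagMatR_eq_card_lines hl hc hcl hP hL h12 hq hf r c₂]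
  have hsame : q ∈ orb3 σ.onPoints p ↔ c₁ = c₂ := by
    constructor
    · intro h
      apply σ.colOrbitR_injective hl hc hcl hP hL h12 hq hf
      rw [hco1, hco2]; exact orb3_eq_of_mem σ.onPoints hq h
    · intro h
      have : q = p := by rw [hqdef, hpdef, h]
      rw [this]; exact self_mem_orb3 _ _
  have hid := σ.orbit_column_identity_orbits hq hpf q
  rw [h12, ← hsum] at hid
  obtain ⟨hZ, htri, hT⟩ := σ.pointRepR_facts hl hc hcl hP hL h12 hq hf
  set G := (univ.filter fun m : L => q ∈ m ∧ p ∈ m ∧ σ.onLines m = m).card with hG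
  have hG0 : (∀ m : L, σ.onLines m = m → q ∈ m → p ∈ m → False) → G = 0 := by
    intro h; rw [hG, card_eq_zero, filter_eq_empty_iff]; intro m _ ⟨h1, h2, h3⟩; exact h m h3 h1 h2
  have hG1 : ∀ m₀ : L, q ∈ m₀ → p ∈ m₀ → σ.onLines m₀ = m₀ → (∀ m : L, σ.onLines m = m → q ∈ m → m = m₀) → G = 1 := by
    intro m₀ h1 h2 h3 huniq
    rw [hG, card_eq_one]
    refine ⟨m₀, ?_⟩
    ext m
    rw [mem_filter, mem_singleton]
    constructor
    · rintro ⟨-, hm1, -, hm3⟩; exact huniq m hm3 hm1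
    · intro h; rw [h]; exact ⟨mem_univ _, h1, h2, h3⟩
  rcases c₁ with t | x | ⟨j, t⟩ <;> rcases c₂ with t' | x' | ⟨j', t'⟩
  · -- Z / Z : the common fixed line l
    have hGv : G = 1 := hG1 l (hZ t).1 (hZ t').1 hl (hZ t).2
    rw [hGv] at hid
    simp only [FlagOrbit.colTarget]
    by_cases htt : t = t'
    · subst htt; rw [if_pos (hsame.2 rfl)] at hid; rw [if_pos rfl]; omega
    · rw [if_neg (fun h => htt (Sum.inl.inj (hsame.1 h)))] at hid; rw [if_neg htt]; omega
  · have hGv : G = 0 := hG0 (fun m hm _ h2 => htri x'.1 x'.2 m hm h2)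
    rw [hGv, if_neg (fun h => by cases hsame.1 h)] at hid
    simp only [FlagOrbit.colTarget]; omega
  · have hGv : G = 0 := hG0 (fun m hm h1 h2 => by
      have e1 := (hZ t).2 m hm h1
      have e2 := (hT j' t').2 m hm h2
      exact (σ.eFixLR hl hc hf j').2.2 (e2.symm.trans e1))
    rw [hGv, if_neg (fun h => by cases hsame.1 h)] at hid
    simp only [FlagOrbit.colTarget]; omega
  · have hGv : G = 0 := hG0 (fun m hm h1 _ => htri x.1 x.2 m hm h1)
    rw [hGv, if_neg (fun h => by cases hsame.1 h)] at hid
    simp only [FlagOrbit.colTarget]; omega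
  · have hGv : G = 0 := hG0 (fun m hm h1 _ => htri x.1 x.2 m hm h1)
    rw [hGv] at hid
    simp only [FlagOrbit.colTarget]
    by_cases hxx : x = x'
    · subst hxx; rw [if_pos (hsame.2 rfl)] at hid; rw [if_pos rfl]; omega
    · rw [if_neg (fun h => hxx (by have := hsame.1 h; simp only [Sum.inr.injEq, Sum.inl.injEq] at this; exact this))] at hid
      rw [if_neg hxx]; omega
  · have hGv : G = 0 := hG0 (fun m hm h1 _ => htri x.1 x.2 m hm h1)
    rw [hGv, if_neg (fun h => by cases hsame.1 h)] at hid
    simp only [FlagOrbit.colTarget]; omega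
  · have hGv : G = 0 := hG0 (fun m hm h1 h2 => by
      have e1 := (hT j t).2 m hm h1
      have e2 := (hZ t').2 m hm h2
      exact (σ.eFixLR hl hc hf j).2.2 (e1.symm.trans e2))
    rw [hGv, if_neg (fun h => by cases hsame.1 h)] at hid
    simp only [FlagOrbit.colTarget]; omega
  · have hGv : G = 0 := hG0 (fun m hm _ h2 => htri x'.1 x'.2 m hm h2)
    rw [hGv, if_neg (fun h => by cases hsame.1 h)] at hid
    simp only [FlagOrbit.colTarget]; omega
  · -- tpt / tpt : common fixed line m_j iff j = j'
    simp only [FlagOrbit.colTarget]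
    by_cases hjj : j = j'
    · subst hjj
      have hGv : G = 1 := hG1 _ (hT j t).1 (hT j t').1 (σ.eFixLR hl hc hf j).2.1 (hT j t).2
      rw [hGv] at hid
      by_cases htt : t = t'
      · subst htt; rw [if_pos (hsame.2 rfl)] at hid; rw [if_pos rfl]; omega
      · rw [if_neg (fun h => htt (by have := hsame.1 h; simp only [Sum.inr.injEq, Prod.mk.injEq, true_and] at this; exact this))] at hid
        rw [if_neg (fun h => htt (by simp only [Prod.mk.injEq, true_and] at h; exact h)), if_pos rfl]; omega
    · have hmm : (σ.eFixLR hl hc hf j).1 ≠ (σ.eFixLR hl hc hf j').1 := fun e => hjj ((σ.eFixLR hl hc hf).injective (Subtype.ext e))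
      have hGv : G = 0 := hG0 (fun m hm h1 h2 => hmm (((hT j t).2 m hm h1).symm.trans ((hT j' t').2 m hm h2)))
      rw [hGv, if_neg (fun h => hjj (by have := hsame.1 h; simp only [Sum.inr.injEq, Prod.mk.injEq] at this; exact this.1))] at hid
      rw [if_neg (fun h => hjj (by simp only [Prod.mk.injEq] at h; exact h.1)), if_neg hjj]; omega

/-- **All seven conjuncts:** the orbit matrix read off the plane satisfies `IsFlagOrbitMatrix ρ`. -/
theorem isFlagOrbitMatrix_ofPlane : IsFlagOrbitMatrix ρ (σ.flagMatR hl hc hcl hP hL h12 hq hf) :=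
  ⟨σ.flagMatR_rowSum hl hc hcl hP hL h12 hq hf, σ.flagMatR_colSum hl hc hcl hP hL h12 hq hf,
    σ.flagMatR_rows hl hc hcl hP hL h12 hq hf, σ.flagMatR_cols hl hc hcl hP hL h12 hq hf,
    σ.flagMatR_gamma hl hc hcl hP hL h12 hq hf, σ.flagMatR_tline_z hl hc hcl hP hL h12 hq hf,
    σ.flagMatR_side_diag hl hc hcl hP hL h12 hq hf⟩

end Data

end Flag

end Collineation

/-- **The generic orbit-matrix reduction of the flag cell holds for every `ρ`** (designs g15's typed statement `FlagOrbitReduction ρ` is a theorem):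
every projective plane of order 12 with a flag-type collineation `σ ≠ 1`, `σ³ = 1`, with exactly `13 − 3ρ` fixed points yields a matrix satisfying
`IsFlagOrbitMatrix ρ`. -/
theorem flagOrbitReduction_holds (ρ : ℕ) : FlagOrbitReduction ρ := by
  intro P L _ _ _ _ h12 σ hq _ hflag
  obtain ⟨l, c, hl, hc, hcl, hP, hL, hf⟩ := hflag
  exact ⟨_, σ.isFlagOrbitMatrix_ofPlane hl hc hcl hP hL h12 hq hf⟩

/-- **Census consequence (pure logic):** if no orbit matrix with `ρ` c-line orbits exists (`NoFlagOrbitMatrix ρ` — UNDECIDED as of 2026-08-23 for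
every `ρ ≥ 1` in this plain form), then no projective plane of order 12 admits a flag-type collineation of order 3 with exactly `13 − 3ρ` fixed points. -/
theorem noFlagFixed_of_noFlagOrbitMatrix {ρ : ℕ} (hno : NoFlagOrbitMatrix ρ) : NoFlagOrder3Order12Fixed (13 - 3 * ρ) :=
  noFlagFixed_of_flagOrbitReduction (flagOrbitReduction_holds ρ) hno

/-- **The four flag sub-cells from the four orbit-matrix statements** `ρ = 4, 3, 2, 1` (`f = 1, 4, 7, 10`). -/
theorem noFlagOrder3_of_flagOrbitMatrices (h4 : NoFlagOrbitMatrix 4) (h3 : NoFlagOrbitMatrix 3) (h2 : NoFlagOrbitMatrix 2)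
    (h1 : NoFlagOrbitMatrix 1) : NoFlagOrder3Order12 :=
  flag_subcells.2 ⟨noFlagFixed_of_noFlagOrbitMatrix h4, noFlagFixed_of_noFlagOrbitMatrix h3, noFlagFixed_of_noFlagOrbitMatrix h2,
    noFlagFixed_of_noFlagOrbitMatrix h1⟩

/-- **The case `ρ = 0` is the ELATION cell:** an elation `σ ≠ 1` of order 3 (axis `l`, centre `c ∈ l`) is of flag type with all `13` points of `l`
fixed (`Involution.fixedCard_eq_of_elation`; semiregularity `CentralCollineation.eq_self_of_central_of_fixed` and its dual), so `NoFlagOrbitMatrix 0`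
(a `48 × 48` system over the T-line / T-point orbits) implies `NoElationOrder3Order12` — in print: Janko–van Trung 1981. -/
theorem noElationOrder3_of_noFlagOrbitMatrix_zero (h0 : NoFlagOrbitMatrix 0) : NoElationOrder3Order12 := by
  intro P L _ _ _ _ h12 σ l c hax hcen hcl hq
  by_contra hne
  have hl : σ.onLines l = l := σ.axis_fixed hax
  have hc : σ.onPoints c = c := σ.center_fixed hax hcen
  have hP : ∀ p : P, σ.onPoints p = p → p ∈ l := by
    intro p hp
    by_contra hpl
    have hpc : p ≠ c := fun h => hpl (h ▸ hcl)
    apply hne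
    ext s
    simpa using σ.eq_self_of_central_of_fixed hax hcen hpl hpc hp s
  have hL : ∀ m : L, σ.onLines m = m → c ∈ m := by
    intro m hm
    by_contra hcm
    have hml : (m : Dual L) ≠ (l : Dual L) := fun h => hcm (by rw [show m = l from h]; exact hcl)
    have hall : ∀ s : Dual L, σ.dual.onPoints s = s :=
      σ.dual.eq_self_of_central_of_fixed (l := (c : Dual P)) (c := (l : Dual L)) (r := (m : Dual L)) hcen hax hcm hml hm
    apply hne
    apply σ.onPoints_eq_one_of_onLines
    ext s
    rw [Equiv.Perm.one_apply]
    exact hall s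
  have hf : fixedCard σ.onPoints = 13 - 3 * 0 := by rw [σ.fixedCard_eq_of_elation hax hcen hcl hne, h12]
  exact noFlagFixed_of_noFlagOrbitMatrix h0 P L h12 σ hq hne ⟨l, c, hl, hc, hcl, hP, hL, hf⟩

/-- **The whole live cell `|G| = 3` from five finite orbit-matrix statements** (`ρ = 0` elation, `ρ = 1, …, 4` flag sub-cells; the planar type is the
theorem `noPlanarOrder3Order12`, Roth 1964 / designs g10). -/
theorem noOrderThree_of_flagOrbitMatrices (h0 : NoFlagOrbitMatrix 0) (h1 : NoFlagOrbitMatrix 1) (h2 : NoFlagOrbitMatrix 2)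
    (h3 : NoFlagOrbitMatrix 3) (h4 : NoFlagOrbitMatrix 4) : NoOrderThreeOrder12 :=
  noOrderThree_of_subcells (noElationOrder3_of_noFlagOrbitMatrix_zero h0) noPlanarOrder3Order12 (noFlagOrder3_of_flagOrbitMatrices h4 h3 h2 h1)

/-- **The flag cell from the FINEST available finite statements:** the plain orbit-matrix statements for `f = 1, 4` (`ρ = 4, 3`, this file) and the
structured ones for `f = 7, 10` (`NoFlagSevenOrbitMatrix`, designs g13/g14; `NoFlagTenOrbitMatrix`, designs g12–g14, decided EMPTY outside the kernel). -/
theorem noFlagOrder3_of_finestOrbitMatrices (h4 : NoFlagOrbitMatrix 4) (h3 : NoFlagOrbitMatrix 3) (h7 : NoFlagSevenOrbitMatrix)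
    (h10 : NoFlagTenOrbitMatrix) : NoFlagOrder3Order12 :=
  noFlagOrder3_of_orbitMatrices (noFlagFixed_of_noFlagOrbitMatrix h4) (noFlagFixed_of_noFlagOrbitMatrix h3) h7 h10

open Literature.Combinatorics.Designs Summit.Ventures.DiscreteObjects.STD in
/-- **Rigid endgame, v9 (finest finite statements).** Janko–van Trung's `{2,3}`-group theorem (named fact), the array statements `NoLiftableSTD2_12_6`
(involution cell) and `NoLiftableSTD3_12_4` (order-3 elation cell), the plain orbit-matrix statements `NoFlagOrbitMatrix 4`, `NoFlagOrbitMatrix 3`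
(`f = 1, 4`; NEW, typed / undecided) and the structured ones `NoFlagSevenOrbitMatrix` (undecided), `NoFlagTenOrbitMatrix` (EMPTY outside the kernel)
force every collineation group of a projective plane of order 12 to be trivial: EVERY hypothesis except Janko–van Trung's theorem is now an explicit
finite statement in the tree. No existence or non-existence sentence about PP(12) is claimed. -/
theorem card_collineationGroup_eq_one_v9 (hJvT : CollineationGroupIsTwoThreeGroup) (h2 : NoLiftableSTD2_12_6) (h3E : NoLiftableSTD3_12_4)
    (h4 : NoFlagOrbitMatrix 4) (h3 : NoFlagOrbitMatrix 3) (h7 : NoFlagSevenOrbitMatrix) (h10 : NoFlagTenOrbitMatrix)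
    (P L : Type) [Membership P L] [Fintype P] [Fintype L] [ProjectivePlane P L] (h12 : ProjectivePlane.order P L = 12)
    (G : Type) [Group G] [Fintype G] [MulAction G P] [MulAction G L] (hG : IsCollineationGroup G P L) :
    Fintype.card G = 1 :=
  card_collineationGroup_eq_one_of_noLiftable hJvT h2
    (noOrderThree_of_arrays h3E noPlanarOrder3Order12 (noFlagOrder3_of_finestOrbitMatrices h4 h3 h7 h10)) P L h12 G hG

open Literature.Combinatorics.Designs Summit.Ventures.DiscreteObjects.STD in
/-- **Rigid endgame, v8 (uniform orbit-matrix form).** Janko–van Trung's `{2,3}`-group theorem (named fact), the finite array statement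
`NoLiftableSTD2_12_6` (involution cell) and the five finite orbit-matrix statements `NoFlagOrbitMatrix ρ`, `ρ = 0, …, 4` (order-3 cells: elation and the
four flag sub-cells `f = 10, 7, 4, 1`) force every collineation group of a projective plane of order 12 to be trivial. Census status 2026-08-23: all five
orbit-matrix hypotheses UNDECIDED in this plain form ('typed / undecided'; `ρ = 0` excluded in print, `ρ = 1` empty at the structured orbit level outside the
kernel); no existence or non-existence sentence about PP(12) is claimed. -/
theorem card_collineationGroup_eq_one_v8 (hJvT : CollineationGroupIsTwoThreeGroup) (h2 : NoLiftableSTD2_12_6)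
    (h0 : NoFlagOrbitMatrix 0) (h1 : NoFlagOrbitMatrix 1) (h2' : NoFlagOrbitMatrix 2) (h3 : NoFlagOrbitMatrix 3) (h4 : NoFlagOrbitMatrix 4)
    (P L : Type) [Membership P L] [Fintype P] [Fintype L] [ProjectivePlane P L] (h12 : ProjectivePlane.order P L = 12)
    (G : Type) [Group G] [Fintype G] [MulAction G P] [MulAction G L] (hG : IsCollineationGroup G P L) :
    Fintype.card G = 1 :=
  card_collineationGroup_eq_one_of_noLiftable hJvT h2 (noOrderThree_of_flagOrbitMatrices h0 h1 h2' h3 h4) P L h12 G hG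

end Summit.Ventures.DiscreteObjects.PP12
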